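import Summits.KontsevichZagierPeriods.KontsevichZagierPeriods.Theorems.HurwitzMicroSectorsHurwitzSectorComplementStubAssemblyAuxDescent

/-!
# `HurwitzSectorComplement` (stmt-KontsevichZagierPeriods-14341), line `chebyshev-level-deformation`,
# stub S5 `stub_assembly` — part 4/4: the composition, as `calc` chains of KZ-equivalences

`stub_assembly` (registered stub of the lead skeleton `Cruxes/HurwitzSectorComplement/Lines/
chebyshev_level_deformation.lean`, sha `35ae5381f713`), verbatim: from the four Chebyshev-ladder
descents (conclusion of S3) and the real-cyclotomic partial fractions (S4), Conjecture 1 of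
Kontsevich–Zagier on the REAL-ALGEBRAIC span of the symmetric (Bernoulli-parity) Hurwitz box tower —
any two representations `[(0,1)^w, Q(t) + R(t)/(1 − t^N)]`, `t = x₁⋯x_w`, `Q, R ∈ (ℚ̄ ∩ ℝ)[t]`,
`deg R < N`, `R` `(−1)^w`-symmetric (`R_{N−1} = 0` for odd `w`), of any weights `w, w' ≥ 2` and levels
`N, N' ≥ 1`, with equal values are KZ-equivalent.

The proof is a pair of `calc` chains in the relation `KZ.Equivalent` (its `Trans` structure is
`KZ.Equivalent.trans`, supplied locally):

* (Red) `Assembly.red_main` (part 3): `r ∼ s ∼ n = [(0,1)^w, C + A·∏ 2/(1+xᵢ²)]`, `C, A ∈ ℚ̄ ∩ ℝ`,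
  and likewise `r' ∼ s' ∼ n'`;
* (Values) a `calc` chain of equalities `C + A(π/2)^w = n.value = r.value = r'.value = n'.value
  = C' + A'(π/2)^{w'}` (soundness `KZ.Equivalent.value_eq_holds`, `Assembly.value_nf`);
* (Rigidity) `Assembly.nf_coeffs_eq` (Lindemann): `C = C'` and `A = A'` (`w = w'`), resp.
  `A = A' = 0` (`w ≠ w'`);
* (Glue) `r ∼ s ∼ n ∼ n' ∼ s' ∼ r'`: for `w = w'` the middle link is one congruence move; for
  `w ≠ w'` it is `n ∼ C ⊙ [(0,1)^w, 1] ∼ C ⊙ [(0,1)^{w'}, 1] ∼ n'` — the landed rational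
  `stub_constAcrossDim` at `c = 1`, scaled by the algebraic constant `C` (`KZ.Equivalent.constMul`).

References: M. Kontsevich, D. Zagier, *Periods* (2001), §1.2 Conjecture 1 and rules (1)–(3).
-/

noncomputable section

open Set MeasureTheory
open scoped BigOperators
open Literature.NumberTheory.Transcendental

namespace Summit.KontsevichZagierPeriods.Theorems.HurwitzMicroSectorsHurwitzSectorComplement

namespace AssemblyCalc

variable {w w' : ℕ}

/-- **Congruence on the open box.** Two representations on the open unit box `(0,1)^w` whose
integrands agree there are KZ-equivalent (one integrand-additivity move against the zero
representation, `KZ.of_sub_of_mem_relations_of_eqOn`). [cite: KontsevichZagier2001, §1.2 rule (1)] -/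
theorem equivalent_of_eqOn_box {s s' : KZ.IntegralRep w} (hsd : s.domain = KZ.unitCube w)
    (hs'd : s'.domain = KZ.unitCube w)
    (h : ∀ x ∈ KZ.unitCube w, s.integrand x = s'.integrand x) : KZ.Equivalent s s' :=
  KZ.of_sub_of_mem_relations_of_eqOn (hs'd.trans hsd.symm) fun x hx => h x (hsd ▸ hx)

/-- **Algebraic constants across dimensions.** Representations on the open unit boxes `(0,1)^w`,
`(0,1)^{w'}` (`w, w' ≥ 1`) whose integrands are the same real ALGEBRAIC constant `C` there are
KZ-equivalent: `n ∼ C ⊙ [(0,1)^w, 1] ∼ C ⊙ [(0,1)^{w'}, 1] ∼ n'`, the middle link being the landed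
rational `stub_constAcrossDim` (`c = 1`: slabs and null faces) pushed through the scaling
endomorphism (`KZ.Equivalent.constMul`), the outer links congruence moves.
[cite: KontsevichZagier2001, §1.2 rules (1), (3)] -/
theorem equivalent_const_across {C : ℝ} (hC : IsAlgebraic ℚ C) (hw : 1 ≤ w) (hw' : 1 ≤ w')
    (n : KZ.IntegralRep w) (n' : KZ.IntegralRep w')
    (hnd : n.domain = KZ.unitCube w) (hn'd : n'.domain = KZ.unitCube w')
    (hni : ∀ x ∈ KZ.unitCube w, n.integrand x = C)
    (hn'i : ∀ x ∈ KZ.unitCube w', n'.integrand x = C) : KZ.Equivalent n n' := by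
  have _t : ∀ {a b c : ℕ}, @Trans (KZ.IntegralRep a) (KZ.IntegralRep b) (KZ.IntegralRep c)
      KZ.Equivalent KZ.Equivalent KZ.Equivalent := fun {a b c} => ⟨KZ.Equivalent.trans⟩
  obtain ⟨K, hKd, hKi⟩ := ConstAcrossDim.exists_constRep w 1
  obtain ⟨K', hK'd, hK'i⟩ := ConstAcrossDim.exists_constRep w' 1
  have hKK' : KZ.Equivalent K K' :=
    stub_constAcrossDim w w' 1 K K' hw hw' hKd (fun x _ => congrFun hKi x) hK'd
      fun x _ => congrFun hK'i x
  calc KZ.Equivalent n (K.constMul C hC) :=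
        equivalent_of_eqOn_box hnd hKd fun x hx => by simp [hni x hx, hKi]
    KZ.Equivalent _ (K'.constMul C hC) := KZ.Equivalent.constMul C hC hKK'
    KZ.Equivalent _ n' := equivalent_of_eqOn_box hK'd hn'd fun x hx => by simp [hn'i x hx, hK'i]

end AssemblyCalc

/-- **S5, assembly** (registered stub `stub_assembly` of the lead skeleton, verbatim). From the four
descents (S3) and the partial fractions (S4): Conjecture 1 on the REAL-ALGEBRAIC span of the
symmetric Hurwitz tower, across all weights `w, w' ≥ 2` and levels `N, N' ≥ 1`. Reduce both
representations to normal forms `[(0,1)^w, C + A·∏ 2/(1+xᵢ²)]` with `C, A` real algebraic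
(`Assembly.red_main`), read off the values `C + A(π/2)^w` by soundness, compare by Lindemann
(`Assembly.nf_coeffs_eq`), and glue by `calc` chains of KZ-equivalences: one congruence move for
`w = w'`, algebraic constants across dimensions (`AssemblyCalc.equivalent_const_across`) for
`w ≠ w'`. [cite: KontsevichZagier2001, §1.2 Conjecture 1] -/
theorem stub_assembly : ((∀ (w j L : ℕ), 2 ≤ w → Even w → 0 < j → 2 * j < L → ∀ (r : KZ.IntegralRep w), r.domain = {x | ∀ i, x i ∈ Set.Ioo (0:ℝ) 1} → Set.EqOn r.integrand (fun x => ((1 - ∏ i, x i) - (Real.tan (Real.pi * j / L)) ^ 2 * (1 + ∏ i, x i)) / ((1 - ∏ i, x i) ^ 2 + (Real.tan (Real.pi * j / L)) ^ 2 * (1 + ∏ i, x i) ^ 2)) r.domain → ∃ q : ℚ, ∀ (s : KZ.IntegralRep w), s.domain = {x | ∀ i, x i ∈ Set.Ioo (0:ℝ) 1} → Set.EqOn s.integrand (fun x => (q : ℝ) * ∏ i, 2 / (1 + (x i) ^ 2)) s.domain → KZ.Equivalent r s) ∧ (∀ (w j L : ℕ), 3 ≤ w → Odd w → 0 < j → 2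 * j < L → ∀ (r : KZ.IntegralRep w), r.domain = {x | ∀ i, x i ∈ Set.Ioo (0:ℝ) 1} → Set.EqOn r.integrand (fun x => 2 * Real.tan (Real.pi * j / L) / ((1 - ∏ i, x i) ^ 2 + (Real.tan (Real.pi * j / L)) ^ 2 * (1 + ∏ i, x i) ^ 2)) r.domain → ∃ q : ℚ, ∀ (s : KZ.IntegralRep w), s.domain = {x | ∀ i, x i ∈ Set.Ioo (0:ℝ) 1} → Set.EqOn s.integrand (fun x => (q : ℝ) * ∏ i, 2 / (1 + (x i) ^ 2)) s.domain → KZ.Equivalent r s) ∧ (∀ (w : ℕ), 2 ≤ w → Even w → ∀ (r : KZ.IntegralRep w), r.domain = {x | ∀ i, x i ∈ Set.Ioo (0:ℝ) 1} → Set.EqOn r.integrand (fun x => 1 / (1 - ∏ i, x i)) r.domain → ∃ q : ℚ, ∀ (s : KZ.IntegralRep w), s.domain = {x | ∀ i, x i ∈ Set.Ioo (0:ℝ) 1} → Set.EqOn s.integrand (fun x => (q : ℝ) * ∏ i, 2 / (1 + (x i) ^ 2)) s.domain → KZ.Equivalent r s) ∧ (∀ (w : ℕ), 2 ≤ w → Even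 w → ∀ (r : KZ.IntegralRep w), r.domain = {x | ∀ i, x i ∈ Set.Ioo (0:ℝ) 1} → Set.EqOn r.integrand (fun x => 1 / (1 + ∏ i, x i)) r.domain → ∃ q : ℚ, ∀ (s : KZ.IntegralRep w), s.domain = {x | ∀ i, x i ∈ Set.Ioo (0:ℝ) 1} → Set.EqOn s.integrand (fun x => (q : ℝ) * ∏ i, 2 / (1 + (x i) ^ 2)) s.domain → KZ.Equivalent r s)) → ((∀ (L a : ℕ), 0 < a → a < L → ∀ (t : ℝ), 0 ≤ t → t < 1 → (t ^ (a - 1) + t ^ (L - 1 - a)) / (1 - t ^ L) = 2 / (L : ℝ) * ∑ j ∈ Finset.range L, Real.cos (2 * Real.pi * j * a / L) * ((Real.cos (2 * Real.pi * j / L) - t) / (1 - 2 * Real.cos (2 * Real.pi * j / L) * t + t ^ 2))) ∧ (∀ (L a : ℕ), 0 < a → a < L → ∀ (t : ℝ), 0 ≤ t → t < 1 → (t ^ (a - 1) - t ^ (L - 1 - a)) / (1 - t ^ L) = 2 / (L : ℝ) * ∑ j ∈ Finset.range L, Real.sin (2 * Real.pi * j * a / L) * (Real.sin (2 * Real.pi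 * j / L) / (1 - 2 * Real.cos (2 * Real.pi * j / L) * t + t ^ 2))) ∧ (∀ (u t : ℝ), 0 < u → u < Real.pi → (Real.cos u - t) / (1 - 2 * Real.cos u * t + t ^ 2) = ((1 - t) - (Real.tan (u / 2)) ^ 2 * (1 + t)) / ((1 - t) ^ 2 + (Real.tan (u / 2)) ^ 2 * (1 + t) ^ 2) ∧ Real.sin u / (1 - 2 * Real.cos u * t + t ^ 2) = 2 * Real.tan (u / 2) / ((1 - t) ^ 2 + (Real.tan (u / 2)) ^ 2 * (1 + t) ^ 2))) → ∀ (w N w' N' : ℕ), 2 ≤ w → 1 ≤ N → 2 ≤ w' → 1 ≤ N' → ∀ (r : KZ.IntegralRep w) (r' : KZ.IntegralRep w'), (∃ (Q R : Polynomial ℝ), (∀ i, IsAlgebraic ℚ (Q.coeff i)) ∧ (∀ i, IsAlgebraic ℚ (R.coeff i)) ∧ R.natDegree < N ∧ (∀ i j : ℕ, i + j + 2 = N → R.coeff i = (-1 : ℝ) ^ w * R.coeff j) ∧ (Odd w → R.coeff (N - 1) = 0) ∧ r.domain = {x | ∀ i, x i ∈ Set.Ioo (0:ℝ) 1} ∧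 Set.EqOn r.integrand (fun x => Polynomial.eval (∏ i, x i) Q + Polynomial.eval (∏ i, x i) R / (1 - (∏ i, x i) ^ N)) r.domain) → (∃ (Q R : Polynomial ℝ), (∀ i, IsAlgebraic ℚ (Q.coeff i)) ∧ (∀ i, IsAlgebraic ℚ (R.coeff i)) ∧ R.natDegree < N' ∧ (∀ i j : ℕ, i + j + 2 = N' → R.coeff i = (-1 : ℝ) ^ w' * R.coeff j) ∧ (Odd w' → R.coeff (N' - 1) = 0) ∧ r'.domain = {x | ∀ i, x i ∈ Set.Ioo (0:ℝ) 1} ∧ Set.EqOn r'.integrand (fun x => Polynomial.eval (∏ i, x i) Q + Polynomial.eval (∏ i, x i) R / (1 - (∏ i, x i) ^ N')) r'.domain) → r.value = r'.value → KZ.Equivalent r r' := by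
  intro hDesc hPF w N w' N' hw hN hw' hN' r r' ⟨Q, R, hQ, hRa, hR, hsym, hodd, hd, hf⟩
    ⟨Q', R', hQ', hRa', hR', hsym', hodd', hd', hf'⟩ hv
  have _t : ∀ {a b c : ℕ}, @Trans (KZ.IntegralRep a) (KZ.IntegralRep b) (KZ.IntegralRep c)
      KZ.Equivalent KZ.Equivalent KZ.Equivalent := fun {a b c} => ⟨KZ.Equivalent.trans⟩
  -- (Red): both representations reduce to normal forms with real algebraic coefficients
  obtain ⟨C, A, s, n, hC, hA, hsd, hnd, hsi, hni, hsn⟩ :=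
    Assembly.red_main hDesc hPF hw hN Q R hQ hRa hR hsym hodd
  obtain ⟨C', A', s', n', hC', hA', hs'd, hn'd, hs'i, hn'i, hs'n'⟩ :=
    Assembly.red_main hDesc hPF hw' hN' Q' R' hQ' hRa' hR' hsym' hodd'
  -- the given representations are congruent to the reduced ones (same box, same integrand on it)
  have hrs : KZ.Equivalent r s :=
    AssemblyCalc.equivalent_of_eqOn_box hd hsd fun x hx => by
      rw [hsi x hx]; exact hf (by rw [hd]; exact hx)
  have hr's' : KZ.Equivalent r' s' :=
    AssemblyCalc.equivalent_of_eqOn_box hd' hs'd fun x hx => by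
      rw [hs'i x hx]; exact hf' (by rw [hd']; exact hx)
  -- (Values): soundness of the calculus transports the equality of values to the normal forms
  have hval : C + A * (Real.pi / 2) ^ w = C' + A' * (Real.pi / 2) ^ w' :=
    calc C + A * (Real.pi / 2) ^ w = n.value := (Assembly.value_nf n hnd hni).symm
      _ = r.value := (KZ.Equivalent.value_eq_holds (hrs.trans hsn)).symm
      _ = r'.value := hv
      _ = n'.value := KZ.Equivalent.value_eq_holds (hr's'.trans hs'n')
      _ = C' + A' * (Real.pi / 2) ^ w' := Assembly.value_nf n' hn'd hn'i
  -- (Rigidity): Lindemann compares the coefficients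
  obtain ⟨hCC, hsame, hdiff⟩ := Assembly.nf_coeffs_eq hC hA hC' hA' (by omega) (by omega) hval
  subst hCC
  by_cases hww : w = w'
  · -- equal weights: the two normal forms coincide on the box (one congruence move)
    subst hww
    have hAA : A = A' := hsame rfl
    subst hAA
    calc KZ.Equivalent r s := hrs
      KZ.Equivalent _ n := hsn
      KZ.Equivalent _ n' :=
        AssemblyCalc.equivalent_of_eqOn_box hnd hn'd fun x hx => by rw [hni x hx, hn'i x hx]
      KZ.Equivalent _ s' := hs'n'.symm
      KZ.Equivalent _ r' := hr's'.symm
  · -- different weights: both normal forms are the algebraic constant `C`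
    obtain ⟨hA0, hA'0⟩ := hdiff hww
    subst hA0
    subst hA'0
    calc KZ.Equivalent r s := hrs
      KZ.Equivalent _ n := hsn
      KZ.Equivalent _ n' :=
        AssemblyCalc.equivalent_const_across hC (by omega) (by omega) n n' hnd hn'd
          (fun x hx => by rw [hni x hx]; ring) fun x hx => by rw [hn'i x hx]; ring
      KZ.Equivalent _ s' := hs'n'.symm
      KZ.Equivalent _ r' := hr's'.symm

end Summit.KontsevichZagierPeriods.Theorems.HurwitzMicroSectorsHurwitzSectorComplement

end
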